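import Literature.IUT.HodgeArakelov.IotaInvariantThetaR

/-!
# [IUTchII] Prop 2.2 (ii) — the LITERAL `ι`-invariance of the frozen `IotaInvariantTheta` vs the geometric `ι`
# (proof-only negative companion, G11; abc-iut-L6-t19, L6-lead ROW 2026-08-25T22:12:06Z (2))

S. Mochizuki, *Inter-universal Teichmüller theory II* (kurims manuscript Dec. 2020) Prop. 2.2 (ii) p. 66,
Cor. 1.12 (i) p. 57; *The étale theta function …* [EtTh] (kurims manuscript) Prop. 1.4 (ii) p. 20
("`Θ̈(Ü) = −Θ̈(Ü⁻¹)`; `Θ̈(−Ü) = −Θ̈(Ü)`"), Rmk. 1.9.1 p. 27 ("the automorphisms `ε_μ`, `ε_±` map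
`η̈^{Θ,ℤ} ↦ −η̈^{Θ,ℤ}`"). Claim key `Mochizuki2012` DISPUTED (D-0012); the theorems below are about the
cell's typings at a classical reading of [EtTh]; nothing takes a side on [IUTchIII] Cor. 3.12.

WHAT THE MODEL SAYS. The inversion `ι` acts trivially on the coefficient cyclotome `Δ_Θ` (`[a⁻¹,b⁻¹] =
[a,b]` in the 2-step quotient) and carries the étale theta class `η` to `η + κ(−1)`, `κ(−1)` the Kummer class
of `−1` — a NONZERO `2`-torsion class (`−1` has order `2` in `K^×`, which injects into its profinite
completion). Hence the GEOMETRIC `ι` has NO literal fixed point on `θ(Π_v)`, while every class of the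
distinguished `μ`-coset is `ι`-invariant UP TO TORSION — the reading of Cor. 1.12 (i) ("`ι`-invariants
with respect to this action up to torsion") typed by the repair `IotaInvariantTheta'` (p408487).

WHAT THE TREE CAN STATE. The cohomology of `EtaleThetaData` is an interface without the `Aut(Π_v)`-action
on `H¹` (audit note F4c), so "the geometric `ι`" enters as a HYPOTHESIS: an additive automorphism `ρ` of
`H¹(Π_Ÿ(Π_v), (l·Δ_Θ)(Π_v))` moving every class of `θ(Π_v)`. Kernel content of this file:
* `IotaInvariantTheta.false_of_fixedPointFree` — NO instance of the frozen (v1, literal) structure has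
  such a `ρ` as its `ι`-action (finding T1-N6, model form: the frozen `Prop22_ii` cannot be witnessed by the
  geometric `ι`; as typed — `ι` a free field — it remains witnessable only by NON-geometric automorphisms);
* `IotaInvariantTheta'.nonempty_ofTorsionShift` — the REPAIRED structure IS instantiated by such a `ρ` as soon as
  `ρ` moves the classes of `θ(Π_v)` by torsion in the printed pattern (one `μ_{2l}`-coset of
  up-to-torsion invariants), e.g. by the constant `2`-torsion shift `κ(−1)` on that coset.
-/

namespace Literature.IUT.HodgeArakelov

universe u

variable {S : BadPlaceSetting.{u}} {P : TopGroup.{u}} {T : TemperedCoverings S P}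
  {D : EtaleThetaData S.toThetaSetting P} {Dec : SubgraphDecomposition S T D}

/-- **T1-N6, model form (negative).** If the `ι`-action of a frozen (v1) `IotaInvariantTheta` datum moves
EVERY class of `θ(Π_v)` — as the geometric inversion does ([EtTh] Prop. 1.4 (ii) p. 20, Rmk. 1.9.1 p. 27:
`η ↦ η + κ(−1)`, `κ(−1) ≠ 0`) — the datum is contradictory: v1's `thetaIota_nonempty` demands a LITERAL fixed
point in `θ(Π_v)`. Hence the frozen `Prop22_ii Dec` has no witness whose `ι` is the geometric one.
[claim: Mochizuki2012, status: disputed] (IUTchII §2 Prop 2.2 (ii), kurims p.66) [cite: Mochizuki2012, Prop 2.2 (ii) p.66] -/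
theorem IotaInvariantTheta.false_of_fixedPointFree (Θ : IotaInvariantTheta Dec)
    (hmoves : ∀ t ∈ D.theta, Θ.iotaH1 t ≠ t) : False := by
  obtain ⟨t, ht, hfix⟩ := Θ.thetaIota_nonempty
  exact hmoves t ht hfix

/-- Reformulation: for a fixed-point-free (on `θ(Π_v)`) additive automorphism `ρ` — the shape of the
geometric `ι` — there is NO v1 datum over `Dec` with `ι`-action `ρ`. [claim: Mochizuki2012, status: disputed] (IUTchII §2 Prop 2.2 (ii), kurims p.66)
[cite: Mochizuki2012, Prop 2.2 (ii) p.66] -/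
theorem IotaInvariantTheta.not_exists_of_fixedPointFree (ρ : D.coh.H1 ⊤ ≃+ D.coh.H1 ⊤)
    (hρ : ∀ t ∈ D.theta, ρ t ≠ t) : ¬ ∃ Θ : IotaInvariantTheta Dec, Θ.iotaH1 = ρ := by
  rintro ⟨Θ, rfl⟩
  exact Θ.false_of_fixedPointFree hρ

/-- A constant NONZERO shift has no fixed point: if `ρ t = t + c` on `θ(Π_v)` with `c ≠ 0` (at the model
`c = κ(−1)`), then `ρ` moves every class of `θ(Π_v)` — so `not_exists_of_fixedPointFree` applies.
[claim: Mochizuki2012, status: disputed] (IUTchII §2 Prop 2.2 (ii), kurims p.66) [cite: Mochizuki2012, Prop 2.2 (ii) p.66] -/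
theorem fixedPointFree_of_shift (ρ : D.coh.H1 ⊤ ≃+ D.coh.H1 ⊤) {c : D.coh.H1 ⊤} (hc : c ≠ 0)
    {X : Set (D.coh.H1 ⊤)} (hshift : ∀ t ∈ X, ρ t = t + c) : ∀ t ∈ X, ρ t ≠ t := by
  intro t ht h
  rw [hshift t ht] at h
  exact hc (by simpa using h)

/-- **T1-N6, model form (positive).** The REPAIRED structure `IotaInvariantTheta'` (p408487) IS
instantiated by an `ι`-action of the geometric shape: given the actions `ρ`, `ρ∞` on `H¹` and on the direct
limit (compatible, `ρ` preserving `θ(Π_v)`), a class `η ∈ θ(Π_v)` moved by a TORSION element (at the model: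
by `κ(−1)`, of order `2`), and the printed orbit property of the up-to-torsion invariants (one
`μ_{2l}`-coset), one obtains the datum — literal fixed points are not needed. [claim: Mochizuki2012, status: disputed] (IUTchII §2 Prop 2.2 (ii), kurims p.66)
[cite: Mochizuki2012, Prop 2.2 (ii) p.66] -/
theorem IotaInvariantTheta'.nonempty_ofTorsionShift (ρ : D.coh.H1 ⊤ ≃+ D.coh.H1 ⊤)
    (ρlim : D.coh.lim ≃+ D.coh.lim)
    (hcompat : ∀ x, D.coh.toLim ⊤ (ρ x) = ρlim (D.coh.toLim ⊤ x)) (hθ : ρ '' D.theta = D.theta)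
    (η : D.coh.H1 ⊤) (hη : η ∈ D.theta) (htors : IsOfFinAddOrder (ρ η - η))
    (horbit : ∀ t ∈ D.theta, ∀ t' ∈ D.theta, IsOfFinAddOrder (ρ t - t) →
      IsOfFinAddOrder (ρ t' - t') → (2 * S.l) • (t' - t) = 0) :
    Nonempty (IotaInvariantTheta' Dec) :=
  ⟨{ iotaH1 := ρ
     iotaLim := ρlim
     iota_compat := hcompat
     iota_theta := hθ
     thetaIota_nonempty := ⟨η, hη, htors⟩
     thetaIota_orbit := horbit }⟩

/-- In particular the geometric situation — `ι` shifts the distinguished class by a nonzero torsion class —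
separates the two typings: no v1 datum with that `ι` (if it moves all of `θ(Π_v)`), but a v2 datum.
[claim: Mochizuki2012, status: disputed] (IUTchII §2 Prop 2.2 (ii), kurims p.66) [cite: Mochizuki2012, Prop 2.2 (ii) p.66] -/
theorem iotaInvariantTheta_v1_v2_separation (ρ : D.coh.H1 ⊤ ≃+ D.coh.H1 ⊤) (ρlim : D.coh.lim ≃+ D.coh.lim)
    (hcompat : ∀ x, D.coh.toLim ⊤ (ρ x) = ρlim (D.coh.toLim ⊤ x)) (hθ : ρ '' D.theta = D.theta)
    (hmoves : ∀ t ∈ D.theta, ρ t ≠ t)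
    (η : D.coh.H1 ⊤) (hη : η ∈ D.theta) (htors : IsOfFinAddOrder (ρ η - η))
    (horbit : ∀ t ∈ D.theta, ∀ t' ∈ D.theta, IsOfFinAddOrder (ρ t - t) →
      IsOfFinAddOrder (ρ t' - t') → (2 * S.l) • (t' - t) = 0) :
    (¬ ∃ Θ : IotaInvariantTheta Dec, Θ.iotaH1 = ρ) ∧ Nonempty (IotaInvariantTheta' Dec) :=
  ⟨IotaInvariantTheta.not_exists_of_fixedPointFree ρ hmoves,
    IotaInvariantTheta'.nonempty_ofTorsionShift ρ ρlim hcompat hθ η hη htors horbit⟩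

end Literature.IUT.HodgeArakelov
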